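import Summits.Ventures.QEC.Census.BB.A1s_n168_k14_8841607e.CoverWitZ1
import Summits.Ventures.QEC.Census.BB.A1s_n168_k14_8841607e.Cert
import HarnessLib

/-!
# Census row `A1s_n168_k14_8841607e` (`[[168,14,10]]`): the LABEL COVER by translations, witnessed and chunked, tier KERNEL (qec-search-10 g3)

C5 with automorphisms for `k = 14` (16383 nonzero labels, 5 representative blocks, 83 listed translations `A1s_n168_k14_8841607e.taus`), in the
table form of `Census/OrbitBZCoverWit2.lean`: `cols_ok` / `Ws_ok` tie the emitted tables `A1s_n168_k14_8841607e.coverTabZ` to type-12's `rhoCols` and to the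
blocks' label bases (one `decide +kernel` each), one `coverAutTabWitOK … = true` theorem per chunk of ≤ 24576 labels checks every label's
packed witness (translation, block, combination) by ONE comparison of two XORs of ≤ 14 small words, and `coverAll : CoverSpan … 1 (2^14)`
(chunks glued by `CoverSpan.append`) is the input of `coverAutTab2_hcover` (= the `hcover` hypothesis of type-10's `bzAut_lower_sound`,
used by `Distance.lean`). The monolithic `coverAutTabOK` is not affordable at k ≥ 14 (measured). Statements name `A1s_n168_k14_8841607e.*` explicitly.
-/

set_option Elab.async false

namespace Summit.Ventures.QEC.Census.A1s_n168_k14_8841607e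

open Summit.Ventures.QEC.Census

set_option maxHeartbeats 4000000 in
/-- The emitted label-action columns ARE type-12's `rhoCols` of the listed translations (KERNEL). -/
theorem cols_ok : A1s_n168_k14_8841607e.taus.map (fun t => rhoCols 2 42 A1s_n168_k14_8841607e.bzAutData.LX A1s_n168_k14_8841607e.bzAutData.LZ t) = A1s_n168_k14_8841607e.coverTabZ.cols := by
  decide +kernel

/-- The emitted label bases ARE the blocks' `W` (KERNEL). -/
theorem Ws_ok : A1s_n168_k14_8841607e.bzAutData.sideZ.blocks.map BZBlock.W = A1s_n168_k14_8841607e.coverTabZ.Ws := by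
  decide +kernel

/-- The listed translations are in range (`t₁ < 2`, `t₂ < 42`). -/
theorem taus_ok : (A1s_n168_k14_8841607e.taus.all fun t => decide (t.1 < 2) && decide (t.2 < 42)) = true := by
  decide

set_option maxHeartbeats 4000000 in
/-- Labels `[1, 16384)` are covered (each by its witnessed block / translation; KERNEL, 16383 one-line checks, split depth 5). -/
theorem covZ_0 : coverAutTabWitOK A1s_n168_k14_8841607e.coverTabZ 84 5 5 1 16383 A1s_n168_k14_8841607e.witsZ_0 = true := by
  decide +kernel

/-- **All 16383 nonzero labels are covered** (chunks glued; the range ends `1 + … = 2^14 = 2^|LZ|`). -/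
theorem coverAll : CoverSpan 2 42 A1s_n168_k14_8841607e.bzAutData.LX A1s_n168_k14_8841607e.bzAutData.LZ A1s_n168_k14_8841607e.taus A1s_n168_k14_8841607e.bzAutData.sideZ.blocks 1 (2 ^ A1s_n168_k14_8841607e.bzAutData.LZ.length) := by
  exact (coverSpan_of_tabWitOK A1s_n168_k14_8841607e.cols_ok A1s_n168_k14_8841607e.Ws_ok A1s_n168_k14_8841607e.covZ_0)

end Summit.Ventures.QEC.Census.A1s_n168_k14_8841607e
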